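import Mathlib

/-!
# Route `FilamentSkeletonRss` · child crux `TangentSkeletonNearStraightL` (stmt-NavierStokesRegularity-23320) · registered line
# `child_tangent_analytic_strip_L` (b0b56c52900dd90a), stub `stub_stripPropagation` — brick: TWO-CONSTANTS ESTIMATE ON A LONG RECTANGLE

The remaining analytic input of the contour shift in `StripPropagation` (see `Theorems.StadiumChord`, p817084) is a TANGENT MODULUS at quarter
height of the stadium: the analytic extension `F′` of the real unit tangent is within `Rb/2` (an angle) of the mean direction ON THE REAL TRACE and
bounded on the whole stadium, and one needs it to stay close to a real unit vector at height `hs/4` — a two-constants (Hadamard–Nevanlinna)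
estimate on a LONG RECTANGLE, where the ends of the stadium must be shown harmless.  This file proves that estimate in the clean scalar form:
* `one_sub_le_cos` — `1 − t ≤ cos(πt/2)` on `[0,1]` (concavity; drives the end barrier);
* `two_constants_rectangle` — for `φ` holomorphic in the rectangle `(−ℓ, ℓ) × (0, H)` and continuous on its closure, `‖φ‖ ≤ M` on the
  closure, `‖φ‖ ≤ m` on the real base `[−ℓ, ℓ]` (`0 < m ≤ M`), and a barrier strength `δ ≥ 0` with `log(M/m) ≤ δ·cosh(πℓ/(2H))`:
  `‖φ(x+iy)‖ ≤ m^{1−y/H}·M^{y/H}·exp(δ·cosh(πx/(2H))·cos(πy/(2H)))` on the closed rectangle.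
  Mechanism: maximum modulus for `φ·E⁻¹·B` with the strip interpolant `E(z) = m^{1+iz/H}M^{−iz/H}` and the end barrier
  `B(z) = exp(−δ·cos(πiz/(2H)))`, `|B(x+iy)| = exp(−δ cosh(πx/2H) cos(πy/2H))`; on the vertical ends `(M/m)^{1−y/H} ≤ exp(δ cosh(πℓ/2H)(1−y/H))
  ≤ 1/|B|` by `one_sub_le_cos`.
  USE: with `δ = log(M/m)/cosh(πℓ/(2H))` the loss factor at `|x| ≤ ℓ − λ` is `≤ (M/m)^{cosh(π(ℓ−λ)/2H)/cosh(πℓ/2H)} ≈ (M/m)^{e^{−πλ/(2H)}}` — harmless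
  one stadium-width away from the ends, which is exactly the quarter-width loss of the stub.
HONEST FRAMING: classical complex analysis serving a plan about a HYPOTHETICAL filament skeleton on the NEGATIVE side of a MODEL route; the stub
`stub_stripPropagation` is NOT closed; nothing here bears on Navier–Stokes regularity or blow-up.  `--supports stmt-NavierStokesRegularity-23320`.
-/

set_option linter.dupNamespace false

noncomputable section

namespace Summit.NavierStokesRegularity.NavierStokesRegularity.Theorems.StadiumTwoConstants

open Set Filter Topology Complex

/-- `1 − t ≤ cos(πt/2)` for `t ∈ [0, 1]` (concavity of the cosine on `[0, π/2]`). [folklore] -/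
theorem one_sub_le_cos {t : ℝ} (h0 : 0 ≤ t) (h1 : t ≤ 1) : 1 - t ≤ Real.cos (Real.pi / 2 * t) := by
  have h := Real.le_sin_mul (x := 1 - t) (by linarith) (by linarith)
  have e : Real.sin (Real.pi / 2 * (1 - t)) = Real.cos (Real.pi / 2 * t) := by
    rw [show Real.pi / 2 * (1 - t) = Real.pi / 2 - Real.pi / 2 * t by ring, Real.sin_pi_div_two_sub]
  rw [e] at h
  exact h

/-- Modulus of the strip interpolant factor `exp(−log m − i z c/H)`: `exp(−log m + Im z · c/H)`. [folklore] -/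
theorem norm_exp_interpolant (m c H : ℝ) (w : ℂ) :
    ‖Complex.exp (-(Real.log m : ℂ) - Complex.I * w * ((c / H : ℝ) : ℂ))‖ = Real.exp (-Real.log m + w.im * (c / H)) := by
  rw [Complex.norm_exp]
  congr 1
  simp only [Complex.sub_re, Complex.neg_re, Complex.ofReal_re, Complex.re_mul_ofReal, Complex.I_mul_re]
  ring

/-- Modulus of the end barrier `exp(−δ·cos(r z i))`: `exp(−δ·cosh(r·Re z)·cos(r·Im z))`. [folklore] -/
theorem norm_exp_barrier (δ r : ℝ) (w : ℂ) :
    ‖Complex.exp (-(δ : ℂ) * Complex.cos ((r : ℂ) * w * Complex.I))‖ =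
      Real.exp (-(δ * (Real.cosh (r * w.re) * Real.cos (r * w.im)))) := by
  rw [Complex.norm_exp]
  congr 1
  have h1 : ((r : ℂ) * w * Complex.I).re = -(r * w.im) := by simp [Complex.mul_re, Complex.mul_im]
  have h2 : ((r : ℂ) * w * Complex.I).im = r * w.re := by simp [Complex.mul_re, Complex.mul_im]
  have hre : (Complex.cos ((r : ℂ) * w * Complex.I)).re = Real.cosh (r * w.re) * Real.cos (r * w.im) := by
    rw [Complex.cos_eq, h1, h2, ← Complex.ofReal_cos, ← Complex.ofReal_cosh, ← Complex.ofReal_sin, ← Complex.ofReal_sinh,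
      ← Complex.ofReal_mul, ← Complex.ofReal_mul, Complex.sub_re, Complex.ofReal_re, Complex.re_ofReal_mul, Complex.I_re,
      mul_zero, sub_zero, Real.cos_neg]
    ring
  rw [neg_mul, Complex.neg_re, Complex.re_ofReal_mul, hre]

/-- **Two-constants estimate on a long rectangle (with end barrier).**  `φ` holomorphic on the open rectangle `(−ℓ, ℓ) × (0, H)` and continuous
on its closure, `‖φ‖ ≤ M` on the closure, `‖φ‖ ≤ m` on the real base, `0 < m ≤ M`, `0 ≤ δ`, `log(M/m) ≤ δ·cosh(πℓ/(2H))`; then on the closed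
rectangle `‖φ(z)‖ ≤ m^{1−Im z/H} · M^{Im z/H} · exp(δ·cosh(π Re z/(2H))·cos(π Im z/(2H)))`. [folklore] -/
theorem two_constants_rectangle {φ : ℂ → ℂ} {ℓ H m M δ : ℝ} (hℓ : 0 < ℓ) (hH : 0 < H) (hm : 0 < m) (hmM : m ≤ M) (hδ : 0 ≤ δ)
    (hφ : DiffContOnCl ℂ φ (Set.Ioo (-ℓ) ℓ ×ℂ Set.Ioo 0 H))
    (hM : ∀ z ∈ closure (Set.Ioo (-ℓ) ℓ ×ℂ Set.Ioo 0 H), ‖φ z‖ ≤ M)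
    (hreal : ∀ x : ℝ, x ∈ Set.Icc (-ℓ) ℓ → ‖φ x‖ ≤ m)
    (hend : Real.log (M / m) ≤ δ * Real.cosh (Real.pi / (2 * H) * ℓ)) :
    ∀ z ∈ closure (Set.Ioo (-ℓ) ℓ ×ℂ Set.Ioo 0 H),
      ‖φ z‖ ≤ m ^ (1 - z.im / H) * M ^ (z.im / H) *
        Real.exp (δ * (Real.cosh (Real.pi / (2 * H) * z.re) * Real.cos (Real.pi / (2 * H) * z.im))) := by
  have hM0 : 0 < M := hm.trans_le hmM
  set c : ℝ := Real.log m - Real.log M with hc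
  set r : ℝ := Real.pi / (2 * H) with hr
  set U : Set ℂ := Set.Ioo (-ℓ) ℓ ×ℂ Set.Ioo 0 H with hU
  set Einv : ℂ → ℂ := fun w => Complex.exp (-(Real.log m : ℂ) - Complex.I * w * ((c / H : ℝ) : ℂ)) with hE
  set bar : ℂ → ℂ := fun w => Complex.exp (-(δ : ℂ) * Complex.cos ((r : ℂ) * w * Complex.I)) with hbar
  set g : ℂ → ℂ := fun w => φ w * Einv w * bar w with hg
  have hEn : ∀ w, ‖Einv w‖ = Real.exp (-Real.log m + w.im * (c / H)) := fun w => norm_exp_interpolant m c H w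
  have hbn : ∀ w, ‖bar w‖ = Real.exp (-(δ * (Real.cosh (r * w.re) * Real.cos (r * w.im)))) := fun w =>
    norm_exp_barrier δ r w
  -- closure and frontier of the rectangle
  have hcl : closure U = Set.Icc (-ℓ) ℓ ×ℂ Set.Icc 0 H := by
    rw [hU, closure_reProdIm, closure_Ioo (by linarith : (-ℓ) ≠ ℓ), closure_Ioo hH.ne]
  have hfr : frontier U = Set.Icc (-ℓ) ℓ ×ℂ ({0, H} : Set ℝ) ∪ ({-ℓ, ℓ} : Set ℝ) ×ℂ Set.Icc 0 H := by
    rw [hU, frontier_reProdIm, closure_Ioo (by linarith : (-ℓ) ≠ ℓ), closure_Ioo hH.ne,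
      frontier_Ioo (by linarith : (-ℓ) < ℓ), frontier_Ioo hH]
  -- `g` is holomorphic inside and continuous up to the boundary
  have hEd : Differentiable ℂ Einv := by
    rw [hE]
    exact Complex.differentiable_exp.comp (by fun_prop)
  have hbd : Differentiable ℂ bar := by
    rw [hbar]
    refine Complex.differentiable_exp.comp ?_
    exact (Complex.differentiable_cos.comp (by fun_prop)).const_mul _
  have hgd : DiffContOnCl ℂ g U :=
    ⟨(hφ.differentiableOn.mul hEd.differentiableOn).mul hbd.differentiableOn,
      (hφ.continuousOn.mul hEd.continuous.continuousOn).mul hbd.continuous.continuousOn⟩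
  -- the boundary bound `‖g‖ ≤ 1`
  have hlogMm : Real.log (M / m) = Real.log M - Real.log m := Real.log_div hM0.ne' hm.ne'
  have hΛ : 0 ≤ Real.log M - Real.log m := by
    have := Real.log_le_log hm hmM; linarith
  have hbdry : ∀ w ∈ frontier U, ‖g w‖ ≤ 1 := by
    intro w hw
    have hwcl : w ∈ closure U := frontier_subset_closure hw
    have hnorm : ‖g w‖ = ‖φ w‖ * ‖Einv w‖ * ‖bar w‖ := by
      simp only [hg, norm_mul]
    rw [hnorm, hEn, hbn]
    rw [hfr] at hw
    rcases hw with hw | hw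
    · -- bottom or top
      obtain ⟨hx, hy⟩ := mem_reProdIm.1 hw
      rcases hy with hy | hy
      · -- bottom: `w` is real
        have hwre : w = ((w.re : ℝ) : ℂ) := Complex.ext (by simp) (by simp [hy])
        have h1 : ‖φ w‖ ≤ m := by rw [hwre]; exact hreal w.re hx
        have h2 : Real.exp (-Real.log m + w.im * (c / H)) = m⁻¹ := by
          rw [hy, zero_mul, add_zero, Real.exp_neg, Real.exp_log hm]
        have h3 : Real.exp (-(δ * (Real.cosh (r * w.re) * Real.cos (r * w.im)))) ≤ 1 := by
          rw [Real.exp_le_one_iff, neg_nonpos, hy, mul_zero, Real.cos_zero, mul_one]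
          exact mul_nonneg hδ (Real.cosh_pos _).le
        rw [h2]
        calc ‖φ w‖ * m⁻¹ * Real.exp (-(δ * (Real.cosh (r * w.re) * Real.cos (r * w.im))))
            ≤ m * m⁻¹ * 1 := by
              gcongr
          _ = 1 := by rw [mul_inv_cancel₀ hm.ne', one_mul]
      · -- top: `Im w = H`
        have hyH : w.im = H := by simpa using hy
        have h1 : ‖φ w‖ ≤ M := hM w hwcl
        have h2 : Real.exp (-Real.log m + w.im * (c / H)) = M⁻¹ := by
          rw [hyH, mul_div_cancel₀ c hH.ne', hc, show -Real.log m + (Real.log m - Real.log M) = -Real.log M by ring,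
            Real.exp_neg, Real.exp_log hM0]
        have h3 : Real.exp (-(δ * (Real.cosh (r * w.re) * Real.cos (r * w.im)))) = 1 := by
          rw [hyH, hr, show Real.pi / (2 * H) * H = Real.pi / 2 by field_simp, Real.cos_pi_div_two]
          simp
        rw [h2, h3, mul_one]
        calc ‖φ w‖ * M⁻¹ ≤ M * M⁻¹ := by gcongr
          _ = 1 := mul_inv_cancel₀ hM0.ne'
    · -- the vertical ends: `Re w = ±ℓ`, `0 ≤ Im w ≤ H`
      obtain ⟨hx, hy⟩ := mem_reProdIm.1 hw
      have h1 : ‖φ w‖ ≤ M := hM w hwcl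
      have hcosh : Real.cosh (r * w.re) = Real.cosh (r * ℓ) := by
        rcases hx with hx | hx
        · rw [hx, mul_neg, Real.cosh_neg]
        · rw [show w.re = ℓ by simpa using hx]
      set t : ℝ := w.im / H with ht
      have ht0 : 0 ≤ t := div_nonneg hy.1 hH.le
      have ht1 : t ≤ 1 := (div_le_one hH).2 hy.2
      have hyt : w.im = t * H := by rw [ht, div_mul_cancel₀ _ hH.ne']
      have hcos : 1 - t ≤ Real.cos (r * w.im) := by
        rw [hyt, hr, show Real.pi / (2 * H) * (t * H) = Real.pi / 2 * t by field_simp]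
        exact one_sub_le_cos ht0 ht1
      -- the exponent is nonpositive
      have hkey : Real.log M + (-Real.log m + w.im * (c / H)) + -(δ * (Real.cosh (r * w.re) * Real.cos (r * w.im))) ≤ 0 := by
        rw [hcosh, hyt, mul_assoc t H, show H * (c / H) = c by field_simp, hc]
        have hA : 0 ≤ δ * Real.cosh (r * ℓ) := mul_nonneg hδ (Real.cosh_pos _).le
        have hend' : Real.log M - Real.log m ≤ δ * Real.cosh (r * ℓ) := by rw [hr, ← hlogMm]; exact hend
        have h3 : (1 - t) * (Real.log M - Real.log m) ≤ δ * Real.cosh (r * ℓ) * Real.cos (r * (t * H)) := by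
          rw [← hyt]
          calc (1 - t) * (Real.log M - Real.log m) ≤ (1 - t) * (δ * Real.cosh (r * ℓ)) :=
                mul_le_mul_of_nonneg_left hend' (by linarith)
            _ ≤ Real.cos (r * w.im) * (δ * Real.cosh (r * ℓ)) := mul_le_mul_of_nonneg_right hcos hA
            _ = δ * Real.cosh (r * ℓ) * Real.cos (r * w.im) := by ring
        nlinarith [h3]
      have hexp : ‖φ w‖ * Real.exp (-Real.log m + w.im * (c / H)) *
          Real.exp (-(δ * (Real.cosh (r * w.re) * Real.cos (r * w.im)))) ≤
          M * Real.exp (-Real.log m + w.im * (c / H)) * Real.exp (-(δ * (Real.cosh (r * w.re) * Real.cos (r * w.im)))) := by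
        gcongr
      refine hexp.trans ?_
      rw [← Real.exp_log hM0, ← Real.exp_add, ← Real.exp_add, Real.exp_le_one_iff]
      exact hkey
  -- maximum modulus
  have hU_bdd : Bornology.IsBounded U := (Metric.isBounded_Ioo _ _).reProdIm (Metric.isBounded_Ioo _ _)
  intro z hz
  have hgz : ‖g z‖ ≤ 1 := Complex.norm_le_of_forall_mem_frontier_norm_le hU_bdd hgd hbdry hz
  -- unwrap
  have hpos : 0 < ‖Einv z‖ * ‖bar z‖ := by rw [hEn, hbn]; positivity
  have hφz : ‖φ z‖ = ‖g z‖ / (‖Einv z‖ * ‖bar z‖) := by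
    rw [eq_div_iff hpos.ne']
    simp only [hg, norm_mul]
    ring
  rw [hφz, div_le_iff₀ hpos]
  refine hgz.trans ?_
  rw [hEn, hbn]
  -- `1 ≤ (m^{1-y/H} M^{y/H} e^{δ…}) · e^{−log m + y c/H} · e^{−δ…}`: in fact equality
  have hrpow : m ^ (1 - z.im / H) * M ^ (z.im / H) = Real.exp (Real.log m * (1 - z.im / H) + Real.log M * (z.im / H)) := by
    rw [Real.rpow_def_of_pos hm, Real.rpow_def_of_pos hM0, ← Real.exp_add]
  rw [hrpow, ← Real.exp_add, ← Real.exp_add, ← Real.exp_add]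
  apply le_of_eq
  have hH0 : H ≠ 0 := hH.ne'
  rw [eq_comm, Real.exp_eq_one_iff, hc]
  field_simp
  ring

/-- **Interior form.**  Under the hypotheses of `two_constants_rectangle`, at points of the closed rectangle with `|Re z| ≤ ℓ'`
(`0 ≤ ℓ'`) the end-barrier loss is at most `exp(δ·cosh(πℓ'/(2H)))`:
`‖φ(z)‖ ≤ m^{1−Im z/H} · M^{Im z/H} · exp(δ·cosh(πℓ'/(2H)))`.  With `δ = log(M/m)/cosh(πℓ/(2H))` and `ℓ' = ℓ − λ` the loss is
`(M/m)^{cosh(π(ℓ−λ)/2H)/cosh(πℓ/2H)}`, i.e. essentially `(M/m)^{exp(−πλ/2H)}`. [folklore] -/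
theorem two_constants_rectangle_interior {φ : ℂ → ℂ} {ℓ H m M δ ℓ' : ℝ} (hℓ : 0 < ℓ) (hH : 0 < H) (hm : 0 < m) (hmM : m ≤ M)
    (hδ : 0 ≤ δ) (hℓ' : 0 ≤ ℓ')
    (hφ : DiffContOnCl ℂ φ (Set.Ioo (-ℓ) ℓ ×ℂ Set.Ioo 0 H))
    (hM : ∀ z ∈ closure (Set.Ioo (-ℓ) ℓ ×ℂ Set.Ioo 0 H), ‖φ z‖ ≤ M)
    (hreal : ∀ x : ℝ, x ∈ Set.Icc (-ℓ) ℓ → ‖φ x‖ ≤ m)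
    (hend : Real.log (M / m) ≤ δ * Real.cosh (Real.pi / (2 * H) * ℓ)) :
    ∀ z ∈ closure (Set.Ioo (-ℓ) ℓ ×ℂ Set.Ioo 0 H), |z.re| ≤ ℓ' →
      ‖φ z‖ ≤ m ^ (1 - z.im / H) * M ^ (z.im / H) * Real.exp (δ * Real.cosh (Real.pi / (2 * H) * ℓ')) := by
  intro z hz hzre
  have h := two_constants_rectangle hℓ hH hm hmM hδ hφ hM hreal hend z hz
  refine h.trans ?_
  have hM0 : 0 < M := hm.trans_le hmM
  have hr : 0 < Real.pi / (2 * H) := by positivity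
  have h1 : Real.cosh (Real.pi / (2 * H) * z.re) * Real.cos (Real.pi / (2 * H) * z.im) ≤ Real.cosh (Real.pi / (2 * H) * ℓ') := by
    have h2 : Real.cosh (Real.pi / (2 * H) * z.re) * Real.cos (Real.pi / (2 * H) * z.im) ≤ Real.cosh (Real.pi / (2 * H) * z.re) :=
      mul_le_of_le_one_right (Real.cosh_pos _).le (Real.cos_le_one _)
    have h3 : Real.cosh (Real.pi / (2 * H) * z.re) ≤ Real.cosh (Real.pi / (2 * H) * ℓ') := by
      rw [Real.cosh_le_cosh, abs_mul, abs_mul, abs_of_pos hr, abs_of_nonneg hℓ']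
      exact mul_le_mul_of_nonneg_left hzre hr.le
    exact h2.trans h3
  have hfac : 0 ≤ m ^ (1 - z.im / H) * M ^ (z.im / H) :=
    mul_nonneg (Real.rpow_nonneg hm.le _) (Real.rpow_nonneg hM0.le _)
  exact mul_le_mul_of_nonneg_left (Real.exp_le_exp.2 (mul_le_mul_of_nonneg_left h1 hδ)) hfac

/-! ## Vector-valued form (appended, same hand)

The stadium-analytic tangent `F′ : ℂ → ℂ³` is vector-valued; the two-constants estimate transfers to any complex normed space by duality
(`NormedSpace.norm_le_dual_bound`: apply the scalar estimate to `f ∘ Φ` for every functional `f`).  With `E = EuclideanSpace ℂ (Fin 3)` this is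
the Euclidean-norm version, which is the one with the best constants for the chord identity. -/

/-- **Two-constants estimate on a long rectangle, vector-valued.**  `Φ : ℂ → E` (`E` a complex normed space) holomorphic in
`(−ℓ, ℓ) × (0, H)` and continuous on the closure, `‖Φ‖ ≤ M` on the closure, `‖Φ‖ ≤ m` on the real base (`0 < m ≤ M`), `0 ≤ δ`,
`log(M/m) ≤ δ·cosh(πℓ/(2H))`; then `‖Φ(z)‖ ≤ m^{1−Im z/H}·M^{Im z/H}·exp(δ·cosh(π Re z/(2H))·cos(π Im z/(2H)))` on the closed rectangle.
[folklore] -/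
theorem two_constants_rectangle_vec {E : Type*} [NormedAddCommGroup E] [NormedSpace ℂ E] {Φ : ℂ → E} {ℓ H m M δ : ℝ}
    (hℓ : 0 < ℓ) (hH : 0 < H) (hm : 0 < m) (hmM : m ≤ M) (hδ : 0 ≤ δ)
    (hΦ : DiffContOnCl ℂ Φ (Set.Ioo (-ℓ) ℓ ×ℂ Set.Ioo 0 H))
    (hM : ∀ z ∈ closure (Set.Ioo (-ℓ) ℓ ×ℂ Set.Ioo 0 H), ‖Φ z‖ ≤ M)
    (hreal : ∀ x : ℝ, x ∈ Set.Icc (-ℓ) ℓ → ‖Φ x‖ ≤ m)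
    (hend : Real.log (M / m) ≤ δ * Real.cosh (Real.pi / (2 * H) * ℓ)) :
    ∀ z ∈ closure (Set.Ioo (-ℓ) ℓ ×ℂ Set.Ioo 0 H),
      ‖Φ z‖ ≤ m ^ (1 - z.im / H) * M ^ (z.im / H) *
        Real.exp (δ * (Real.cosh (Real.pi / (2 * H) * z.re) * Real.cos (Real.pi / (2 * H) * z.im))) := by
  intro z hz
  have hM0 : 0 < M := hm.trans_le hmM
  set Bd : ℝ := m ^ (1 - z.im / H) * M ^ (z.im / H) *
    Real.exp (δ * (Real.cosh (Real.pi / (2 * H) * z.re) * Real.cos (Real.pi / (2 * H) * z.im))) with hBd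
  have hBd0 : 0 ≤ Bd := by rw [hBd]; positivity
  refine NormedSpace.norm_le_dual_bound ℂ (Φ z) hBd0 fun f => ?_
  by_cases hf0 : ‖f‖ = 0
  · have : ‖f (Φ z)‖ ≤ ‖f‖ * ‖Φ z‖ := f.le_opNorm _
    rw [hf0, zero_mul] at this
    rw [hf0, mul_zero]
    exact this
  have hfpos : 0 < ‖f‖ := lt_of_le_of_ne (norm_nonneg _) (Ne.symm hf0)
  -- the scalar function `f ∘ Φ`
  have hφ : DiffContOnCl ℂ (fun w => f (Φ w)) (Set.Ioo (-ℓ) ℓ ×ℂ Set.Ioo 0 H) :=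
    ⟨f.differentiable.comp_differentiableOn hΦ.differentiableOn, f.continuous.comp_continuousOn hΦ.continuousOn⟩
  have hM' : ∀ w ∈ closure (Set.Ioo (-ℓ) ℓ ×ℂ Set.Ioo 0 H), ‖f (Φ w)‖ ≤ ‖f‖ * M := fun w hw =>
    (f.le_opNorm _).trans (mul_le_mul_of_nonneg_left (hM w hw) (norm_nonneg _))
  have hreal' : ∀ x : ℝ, x ∈ Set.Icc (-ℓ) ℓ → ‖f (Φ x)‖ ≤ ‖f‖ * m := fun x hx =>
    (f.le_opNorm _).trans (mul_le_mul_of_nonneg_left (hreal x hx) (norm_nonneg _))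
  have hm' : 0 < ‖f‖ * m := mul_pos hfpos hm
  have hmM' : ‖f‖ * m ≤ ‖f‖ * M := mul_le_mul_of_nonneg_left hmM (norm_nonneg _)
  have hend' : Real.log (‖f‖ * M / (‖f‖ * m)) ≤ δ * Real.cosh (Real.pi / (2 * H) * ℓ) := by
    rw [mul_div_mul_left _ _ hfpos.ne']; exact hend
  have h := two_constants_rectangle hℓ hH hm' hmM' hδ hφ hM' hreal' hend' z hz
  -- `(‖f‖ m)^{1-t} (‖f‖ M)^t = ‖f‖ · m^{1-t} M^t`
  have hsplit : (‖f‖ * m) ^ (1 - z.im / H) * (‖f‖ * M) ^ (z.im / H) = ‖f‖ * (m ^ (1 - z.im / H) * M ^ (z.im / H)) := by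
    rw [Real.mul_rpow (norm_nonneg _) hm.le, Real.mul_rpow (norm_nonneg _) hM0.le]
    have hf1 : ‖f‖ ^ (1 - z.im / H) * ‖f‖ ^ (z.im / H) = ‖f‖ := by
      rw [← Real.rpow_add hfpos, show 1 - z.im / H + z.im / H = 1 by ring, Real.rpow_one]
    calc ‖f‖ ^ (1 - z.im / H) * m ^ (1 - z.im / H) * (‖f‖ ^ (z.im / H) * M ^ (z.im / H))
        = (‖f‖ ^ (1 - z.im / H) * ‖f‖ ^ (z.im / H)) * (m ^ (1 - z.im / H) * M ^ (z.im / H)) := by ring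
      _ = ‖f‖ * (m ^ (1 - z.im / H) * M ^ (z.im / H)) := by rw [hf1]
  rw [hsplit] at h
  calc ‖f (Φ z)‖ ≤ ‖f‖ * (m ^ (1 - z.im / H) * M ^ (z.im / H)) *
        Real.exp (δ * (Real.cosh (Real.pi / (2 * H) * z.re) * Real.cos (Real.pi / (2 * H) * z.im))) := h
    _ = Bd * ‖f‖ := by rw [hBd]; ring

end Summit.NavierStokesRegularity.NavierStokesRegularity.Theorems.StadiumTwoConstants

end
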